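import Summits.MatrixMultiplication.MatrixMultiplication.Theorems.AbelianSTPPCensusVQKWitness486

/-!
# The thin family `(8,6,6)⁴ + small` at orders 477 and 480 under vP ∧ E3⁺ ∧ E3K (cell mm-stpp, eng-2 g7; probe kit j284170)

Supersedes `AbelianSTPPCensusVQKWitness486.lean` as the EXPLICIT UPPER END of the strengthened shape instrument
vQK := vP ∧ E3⁺ ∧ E3K (`SieveAdmissibleVP ∧ STPPThreeRoomEnergy.E3pAdm ∧ STPPThreeRoomEnergy.E3kAdm`).  eng-2 g7's E3⁺⁺ probe
(planner engine A″+G with the pair rule as node test, kit j284170, one enumeration lineage, τ = 5/2 exhaustive at 472–480) found the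
orders 472, 474, 479 EXCLUDED and the thin family `(8,6,6)⁴ + (one small member)` alive from 473 on; E3K kills its members at 473
(`no_8666x4_344_at_473`), and (on the recorded witnesses) at 475 and 476, but NOT at 477 and not at 480:

* `(8,6,6)⁴ + (5,4,3)` at `477 = 9·53`: vP-admissible (`w477_admissible`), E3⁺- and E3K-admissible (`w477_e3pAdm`, `w477_e3kAdm`; heavy-member
  E3K margin `124` in the best pair class — `477` has the divisor `53 ≥ 48 = 8·6`, so the pair class `Q_AB` may be an order-53 coset and
  Kneser gives only `|Q| ≥ 53`), and 5/2-beating (`w477_beats`: `4·288^{5/6} + 60^{5/6} ≥ 4·112 + 30.3 = 478.3 > 477`);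
* `(8,6,6)⁴ + (4,4,4)` at `480 = 2⁵·3·5`: the same with E3K margin `4 512` (`w480_e3k_slack`) — the Kneser minima there are (next to) the trivial coset values
  (`knLB 480 6 = 6`, `knLB 480 8 = 8`, `knLB 480 48 = 48`, `knLB 480 36 = 40`), so E3K ≈ E3⁺⁺ and no refinement of the energy family reaches this list.

Hence `vqkCensusTE_fails_at_477` / `vqkCensusTE_false_above_477` (and the 480 twins): the first vQK-alive order is `≤ 477`; with
`no_6668x4_344_at_472/473`, `no_8666x4_344_at_473` (kernel) and the probe's EXCLUDED verdict at 474 (one lineage) it lies in `[475, 477]`,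
to be settled by the E3K probe (kit j286153).  WHAT THIS IS NOT: no STPP family with these shapes is claimed to exist; no census number of
record (the registered instrument vQ's first-alive order 472 is untouched); no `ω` statement.
-/

-- single-conjunct summit: the mandated namespace repeats `MatrixMultiplication`.
set_option linter.dupNamespace false
set_option autoImplicit false

namespace Summit.MatrixMultiplication.MatrixMultiplication.Theorems

namespace AbelianSTPPCensusVP

open Finset STPPThreeRoomEnergy

/-! ## Order 477: `(8,6,6)⁴ + (5,4,3)` = size vectors `![8,8,8,8,5]`, `![6,6,6,6,4]`, `![6,6,6,6,3]` -/

/-- The 477 witness beats `5/2` (certified sixth-power bounds `112 ≤ 288^{5/6}`, `30.3 ≤ 60^{5/6}`; `4·112 + 30.3 = 478.3 > 477`). [original] -/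
theorem w477_beats : Beats (5 / 2) 477 (![8, 8, 8, 8, 5] : Fin 5 → ℕ) ![6, 6, 6, 6, 4] ![6, 6, 6, 6, 3] := by
  unfold Beats
  have h1 : (112 : ℝ) ≤ (288 : ℝ) ^ ((5 : ℝ) / 6) := le_rpow_five_sixths (by norm_num) (by norm_num) (by norm_num)
  have h2 : (30.3 : ℝ) ≤ (60 : ℝ) ^ ((5 : ℝ) / 6) := le_rpow_five_sixths (by norm_num) (by norm_num) (by norm_num)
  have hexp : ((5 : ℝ) / 2 / 3) = (5 : ℝ) / 6 := by norm_num
  simp only [Fin.sum_univ_five, shapeVol, hexp]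
  simp only [Matrix.cons_val_zero, Matrix.cons_val_one, Matrix.cons_val]
  norm_num
  linarith

set_option maxRecDepth 20000 in
/-- The 477 witness is vP-admissible at the composite order `477 = 9·53` (vM by evaluation; U11-G in all three letter forms; U11-P not
invoked). [original] -/
theorem w477_admissible : SieveAdmissibleVP 477 (![8, 8, 8, 8, 5] : Fin 5 → ℕ) ![6, 6, 6, 6, 4] ![6, 6, 6, 6, 3] := by
  refine ⟨?_, ?_, fun hp => absurd hp (by norm_num)⟩
  · refine ⟨by decide, by decide, by decide, by decide, by decide, ?_, ?_⟩
    · intro l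
      refine ⟨by revert l; decide, fun h => absurd h (by revert l; decide), by revert l; decide,
        fun h => absurd h (by revert l; decide), by revert l; decide, fun h => absurd h (by revert l; decide)⟩
    · intro l
      refine ⟨fun h _ => absurd h (by revert l; decide), fun h _ => absurd h (by revert l; decide),
        fun h _ => absurd h (by revert l; decide)⟩
  · refine ⟨?_, ?_, ?_⟩ <;> (unfold U11GFormB; decide)

/-- The 477 witness is E3⁺-admissible. [original] -/
theorem w477_e3pAdm : E3pAdm 477 (![8, 8, 8, 8, 5] : Fin 5 → ℕ) ![6, 6, 6, 6, 4] ![6, 6, 6, 6, 3] := by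
  intro t _
  revert t
  decide

/-- The 477 witness is E3K-admissible (all three pair classes). [original] -/
theorem w477_e3kAdm : E3kAdm 477 (![8, 8, 8, 8, 5] : Fin 5 → ℕ) ![6, 6, 6, 6, 4] ![6, 6, 6, 6, 3] := by
  unfold E3kAdm E3kAdmAB
  decide +kernel

/-- E3K margin of a heavy member `(8,6,6)` of the 477 witness in the best pair class, `(B,C)` (data rotated to `(b,c,a)`): off-member sums
`159, 164, 120`, `288² − e3kLHS = 124`. [bookkeeping] -/
theorem w477_e3k_slack : 288 ^ 2 - e3kLHS 477 6 6 8 159 164 120 = 124 := by decide +kernel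

/-- **The instrument vP ∧ E3⁺ ∧ E3K is blind at order 477 for T_E.** [original] -/
theorem vqkCensusTE_fails_at_477 :
    ∃ (N : ℕ) (a b c : Fin N → ℕ), 2 ≤ N ∧ SieveAdmissibleVP 477 a b c ∧ E3pAdm 477 a b c ∧ E3kAdm 477 a b c ∧
      Beats (5 / 2) 477 a b c :=
  ⟨5, _, _, _, by norm_num, w477_admissible, w477_e3pAdm, w477_e3kAdm, w477_beats⟩

/-- **No census statement built on vP ∧ E3⁺ ∧ E3K reaches any order `M ≥ 477` for T_E.** [original] -/
theorem vqkCensusTE_false_above_477 {M : ℕ} (hM : 477 ≤ M) :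
    ¬ (∀ (N M' : ℕ) (a b c : Fin N → ℕ), 2 ≤ N → M' ≤ M → SieveAdmissibleVP M' a b c → E3pAdm M' a b c → E3kAdm M' a b c →
        ¬ Beats (5 / 2) M' a b c) :=
  fun h => h 5 477 _ _ _ (by norm_num) hM w477_admissible w477_e3pAdm w477_e3kAdm w477_beats

/-! ## Order 480: `(8,6,6)⁴ + (4,4,4)` — the robust member of the thin family -/

/-- The 480 witness beats `5/2` (certified bounds `112.07 ≤ 288^{5/6}`, `32 ≤ 64^{5/6}`; `4·112.07 + 32 = 480.28 > 480`). [original] -/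
theorem w480_beats : Beats (5 / 2) 480 (![8, 8, 8, 8, 4] : Fin 5 → ℕ) ![6, 6, 6, 6, 4] ![6, 6, 6, 6, 4] := by
  unfold Beats
  have h1 : (112.07 : ℝ) ≤ (288 : ℝ) ^ ((5 : ℝ) / 6) := le_rpow_five_sixths (by norm_num) (by norm_num) (by norm_num)
  have h2 : (32 : ℝ) ≤ (64 : ℝ) ^ ((5 : ℝ) / 6) := le_rpow_five_sixths (by norm_num) (by norm_num) (by norm_num)
  have hexp : ((5 : ℝ) / 2 / 3) = (5 : ℝ) / 6 := by norm_num
  simp only [Fin.sum_univ_five, shapeVol, hexp]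
  simp only [Matrix.cons_val_zero, Matrix.cons_val_one, Matrix.cons_val]
  norm_num
  linarith

set_option maxRecDepth 20000 in
/-- The 480 witness is vP-admissible (`480 = 2⁵·3·5` composite; U11-G in all three letter forms). [original] -/
theorem w480_admissible : SieveAdmissibleVP 480 (![8, 8, 8, 8, 4] : Fin 5 → ℕ) ![6, 6, 6, 6, 4] ![6, 6, 6, 6, 4] := by
  refine ⟨?_, ?_, fun hp => absurd hp (by norm_num)⟩
  · refine ⟨by decide, by decide, by decide, by decide, by decide, ?_, ?_⟩
    · intro l
      refine ⟨by revert l; decide, fun h => absurd h (by revert l; decide), by revert l; decide,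
        fun h => absurd h (by revert l; decide), by revert l; decide, fun h => absurd h (by revert l; decide)⟩
    · intro l
      refine ⟨fun h _ => absurd h (by revert l; decide), fun h _ => absurd h (by revert l; decide),
        fun h _ => absurd h (by revert l; decide)⟩
  · refine ⟨?_, ?_, ?_⟩ <;> (unfold U11GFormB; decide)

/-- The 480 witness is E3⁺-admissible. [original] -/
theorem w480_e3pAdm : E3pAdm 480 (![8, 8, 8, 8, 4] : Fin 5 → ℕ) ![6, 6, 6, 6, 4] ![6, 6, 6, 6, 4] := by
  intro t _
  revert t
  decide

/-- The 480 witness is E3K-admissible. [original] -/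
theorem w480_e3kAdm : E3kAdm 480 (![8, 8, 8, 8, 4] : Fin 5 → ℕ) ![6, 6, 6, 6, 4] ![6, 6, 6, 6, 4] := by
  unfold E3kAdm E3kAdmAB
  decide +kernel

/-- E3K margin of a heavy member `(8,6,6)` of the 480 witness in the best pair class `(B,C)` (data rotated to `(b,c,a)`): `288² − e3kLHS = 4 512`;
the Kneser minima at 480 are (next to) the trivial coset values (`knLB 480 6 = 6`, `knLB 480 8 = 8`, `knLB 480 48 = 48`, `knLB 480 36 = 40`).
[bookkeeping] -/
theorem w480_e3k_slack : 288 ^ 2 - e3kLHS 480 6 6 8 160 160 124 = 4512 ∧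
    knLB 480 6 = 6 ∧ knLB 480 8 = 8 ∧ knLB 480 48 = 48 ∧ knLB 480 36 = 40 := by decide +kernel

/-- **The instrument vP ∧ E3⁺ ∧ E3K is blind at order 480 for T_E** (robustly: margin `4 512`). [original] -/
theorem vqkCensusTE_fails_at_480 :
    ∃ (N : ℕ) (a b c : Fin N → ℕ), 2 ≤ N ∧ SieveAdmissibleVP 480 a b c ∧ E3pAdm 480 a b c ∧ E3kAdm 480 a b c ∧
      Beats (5 / 2) 480 a b c :=
  ⟨5, _, _, _, by norm_num, w480_admissible, w480_e3pAdm, w480_e3kAdm, w480_beats⟩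

end AbelianSTPPCensusVP

end Summit.MatrixMultiplication.MatrixMultiplication.Theorems
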